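import Literature.MathematicalPhysics.KineticTheory.HardSphereEulerProofs
import HarnessLib

/-!
# Tools for `TiltTransfer` (support item stmt-AtomisticToContinuum-12131, route `RingDensityCertificate`)

Helper lemmas for the Cauchy–Schwarz transfer against the homogeneous law
(`Theorems/RingDensityCertificateTiltTransfer.lean`):

* `exponent_bound`, `sq_mul_le_aux`, `profile_sq_le` — pointwise Gaussian domination of the local
  Gibbs profile, `(a₀(x) M_{1,u₀(x),θ₀(x)}(v))² ≤ K₀ · M_{1,0,θ''}(v) · M_{1,0,θc}(v)` with
  `θ'' = θc(θmax + 2θc)/(2θc − θmax)`, valid iff `θmax < 2θc` (Peter–Paul with parameter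
  `(2θc − θmax)/(2θmax)`; the defect is the square `((2θc−θmax)‖v−u‖ − 2θmax‖u‖)²`);
* `density_le_sqrt_mul`, `indicator_tensorPow_sq_le` — the pointwise Cauchy–Schwarz splitting of the
  canonical densities and its tensorisation on the hard-sphere domain;
* `pow_mul_posPartition_one_le`, `lintegral_indicator_tensorPow_one` — comparison of configurational
  partition functions `a_minⁿ Z_pos[1] ≤ Z_pos[a₀]` and `∫ 𝟙_D M_θ^{⊗n} dz = Z_pos[1]` (velocities
  integrate to one, `lintegral_gibbsWeight_mul`).

References: C. Kipnis, C. Landim, *Scaling Limits of Interacting Particle Systems* (1999), Ch. 10;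
H. Spohn, *Large Scale Dynamics of Interacting Particles* (1991), Part I §2.3.
-/

noncomputable section

namespace Summit.AtomisticToContinuum.HydrodynamicLimit.Theorems

open MeasureTheory Filter Set Real
open scoped ENNReal
open Literature.Analysis.FluidPDE Literature.MathematicalPhysics.KineticTheory

namespace RingDensityCertificateTiltTransfer

/-! ### Real-variable inequalities -/

/-- The exponent inequality behind the Gaussian domination: for `0 < θ ≤ θmax < 2θc` and `‖u‖ ≤ U`,
`-‖v-u‖²/θ ≤ 2U²/(2θc-θmax) - ‖v‖²/(2θ'') - ‖v‖²/(2θc)` with `θ'' = θc(θmax+2θc)/(2θc-θmax)`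
(Peter–Paul; after clearing denominators the defect is the square
`((2θc-θmax)‖v-u‖ - 2θmax‖u‖)²`). [folklore] -/
theorem exponent_bound {θmax θc U θ : ℝ} (hθmax : 0 < θmax) (hθc2 : θmax < 2 * θc)
    (hθ : 0 < θ) (hθle : θ ≤ θmax) (u v : V3) (hu : ‖u‖ ≤ U) :
    -‖v - u‖ ^ 2 / (2 * θ) + -‖v - u‖ ^ 2 / (2 * θ) ≤
      2 * U ^ 2 / (2 * θc - θmax) +
        (-‖v‖ ^ 2 / (2 * (θc * (θmax + 2 * θc) / (2 * θc - θmax))) + -‖v‖ ^ 2 / (2 * θc)) := by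
  have hs : 0 < 2 * θc - θmax := by linarith
  have hθc : 0 < θc := by linarith
  have hsum : 0 < θmax + 2 * θc := by linarith
  have hsne : 2 * θc - θmax ≠ 0 := hs.ne'
  have hθcne : θc ≠ 0 := hθc.ne'
  have hsumne : θmax + 2 * θc ≠ 0 := hsum.ne'
  have hθne : θ ≠ 0 := hθ.ne'
  set p := ‖v - u‖ with hp
  set q := ‖u‖ with hq
  set m := ‖v‖ with hm
  have hp0 : 0 ≤ p := norm_nonneg _
  have hq0 : 0 ≤ q := norm_nonneg _
  have hm0 : 0 ≤ m := norm_nonneg _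
  have hmpq : m ≤ p + q := by
    have h := norm_sub_norm_le v u
    rw [← hp, ← hq, ← hm] at h
    linarith
  -- the two sides in closed form
  have e1 : -p ^ 2 / (2 * θ) + -p ^ 2 / (2 * θ) = -(p ^ 2 / θ) := by
    field_simp
    ring
  have e2 : -m ^ 2 / (2 * (θc * (θmax + 2 * θc) / (2 * θc - θmax))) + -m ^ 2 / (2 * θc) =
      -(2 * m ^ 2 / (θmax + 2 * θc)) := by
    field_simp
    ring
  -- monotonicity in the temperature
  have hA : p ^ 2 / θmax ≤ p ^ 2 / θ := div_le_div_of_nonneg_left (sq_nonneg p) hθ hθle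
  -- the core quadratic inequality
  have core : 2 * (p + q) ^ 2 / (θmax + 2 * θc) ≤ p ^ 2 / θmax + 2 * q ^ 2 / (2 * θc - θmax) := by
    rw [div_add_div _ _ hθmax.ne' hsne, div_le_div_iff₀ hsum (mul_pos hθmax hs)]
    nlinarith [sq_nonneg ((2 * θc - θmax) * p - 2 * θmax * q)]
  have hm2 : 2 * m ^ 2 / (θmax + 2 * θc) ≤ 2 * (p + q) ^ 2 / (θmax + 2 * θc) := by
    have h : m ^ 2 ≤ (p + q) ^ 2 := pow_le_pow_left₀ hm0 hmpq 2
    exact div_le_div_of_nonneg_right (by linarith) hsum.le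
  have hq2 : 2 * q ^ 2 / (2 * θc - θmax) ≤ 2 * U ^ 2 / (2 * θc - θmax) := by
    have h : q ^ 2 ≤ U ^ 2 := pow_le_pow_left₀ hq0 hu 2
    exact div_le_div_of_nonneg_right (by linarith) hs.le
  rw [e1, e2]
  linarith

/-- The algebra of the Gaussian domination: `(a cθ eθ)² ≤ (A cmin)² E/(c'' cc) · (c'' e'') (cc ec)` from
`0 ≤ a ≤ A`, `0 ≤ cθ ≤ cmin`, `eθ² ≤ E e'' ec`, `c'', cc > 0`. [folklore] -/
theorem sq_mul_le_aux {a A cθ cmin eθ E c'' e'' cc ec : ℝ} (ha0 : 0 ≤ a) (haA : a ≤ A)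
    (hcθ0 : 0 ≤ cθ) (hcθ : cθ ≤ cmin) (he : eθ ^ 2 ≤ E * (e'' * ec))
    (hc'' : 0 < c'') (hcc : 0 < cc) :
    (a * (cθ * eθ)) ^ 2 ≤ (A * cmin) ^ 2 * E / (c'' * cc) * ((c'' * e'') * (cc * ec)) := by
  have h1 : (a * cθ) ^ 2 ≤ (A * cmin) ^ 2 :=
    pow_le_pow_left₀ (mul_nonneg ha0 hcθ0) (mul_le_mul haA hcθ hcθ0 (ha0.trans haA)) 2
  have hc''ne : c'' ≠ 0 := hc''.ne'
  have hccne : cc ≠ 0 := hcc.ne'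
  calc (a * (cθ * eθ)) ^ 2 = (a * cθ) ^ 2 * eθ ^ 2 := by ring
    _ ≤ (A * cmin) ^ 2 * (E * (e'' * ec)) := mul_le_mul h1 he (sq_nonneg _) (sq_nonneg _)
    _ = (A * cmin) ^ 2 * E / (c'' * cc) * ((c'' * e'') * (cc * ec)) := by
        field_simp

/-- The Cauchy–Schwarz splitting of the densities: if `iP² ≤ K iR iQ` then
`Z_P⁻¹ iP ≤ √((Z_Q/Z_P²) K iR) · √(Z_Q⁻¹ iQ)`. [folklore] -/
theorem density_le_sqrt_mul {iP iQ iR ZP ZQ K : ℝ} (hiP : 0 ≤ iP) (hiQ : 0 ≤ iQ) (hiR : 0 ≤ iR)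
    (hZP : 0 < ZP) (hZQ : 0 < ZQ) (hK : 0 ≤ K) (h : iP ^ 2 ≤ K * (iR * iQ)) :
    ZP⁻¹ * iP ≤ Real.sqrt (ZQ / ZP ^ 2 * K * iR) * Real.sqrt (ZQ⁻¹ * iQ) := by
  have hne : ZP ≠ 0 := hZP.ne'
  have hneQ : ZQ ≠ 0 := hZQ.ne'
  have h0 : 0 ≤ ZQ / ZP ^ 2 * K * iR := by positivity
  rw [← Real.sqrt_mul h0]
  refine (Real.le_sqrt (by positivity) (by positivity)).2 ?_
  have hid : ZQ / ZP ^ 2 * K * iR * (ZQ⁻¹ * iQ) = (ZP⁻¹) ^ 2 * (K * (iR * iQ)) := by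
    field_simp
  rw [hid, mul_pow]
  exact mul_le_mul_of_nonneg_left h (sq_nonneg _)

/-! ### Gaussian domination of the local Gibbs profile -/

variable {a₀ θ₀ : T3 → ℝ} {u₀ : T3 → V3} {θc : ℝ}

/-- **Pointwise Gaussian domination.** For continuous `a₀ > 0`, `θ₀ > 0`, `u₀` on the compact torus and
`θ₀ < 2θc` there are `θ'' > 0` and `K₀ ≥ 0` with
`(a₀(x) M_{1,u₀(x),θ₀(x)}(v))² ≤ K₀ · M_{1,0,θ''}(v) · M_{1,0,θc}(v)` for all `(x, v)`, i.e.
`f_P² ≤ K₀ f_{θ''} f_Q` for the local Gibbs profiles. [folklore] -/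
theorem profile_sq_le (ha : Continuous a₀) (hθ : Continuous θ₀) (hu : Continuous u₀)
    (ha0 : ∀ x, 0 < a₀ x) (hθ0 : ∀ x, 0 < θ₀ x) (hθc : ∀ x, θ₀ x < 2 * θc) :
    ∃ θ'' K₀ : ℝ, 0 < θ'' ∧ 0 ≤ K₀ ∧ ∀ y : T3 × V3,
      localGibbsProfile a₀ u₀ θ₀ y ^ 2 ≤
        K₀ * (localGibbsProfile 1 0 (fun _ => θ'') y * localGibbsProfile 1 0 (fun _ => θc) y) := by
  -- extrema and bounds of the profiles on the compact torus
  obtain ⟨xM, -, hxM⟩ := isCompact_univ.exists_isMaxOn univ_nonempty hθ.continuousOn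
  obtain ⟨xm, -, hxm⟩ := isCompact_univ.exists_isMinOn univ_nonempty hθ.continuousOn
  obtain ⟨A, -, hA⟩ := exists_forall_abs_le_of_continuous ha
  obtain ⟨U, -, hU⟩ := exists_forall_abs_le_of_continuous hu.norm
  have hθmax : ∀ x, θ₀ x ≤ θ₀ xM := fun x => isMaxOn_iff.1 hxM x (mem_univ x)
  have hθmin : ∀ x, θ₀ xm ≤ θ₀ x := fun x => isMinOn_iff.1 hxm x (mem_univ x)
  have hθmin0 : 0 < θ₀ xm := hθ0 xm
  have hθmax0 : 0 < θ₀ xM := hθ0 xM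
  have h2 : θ₀ xM < 2 * θc := hθc xM
  have hθc0 : 0 < θc := by linarith
  have hs : 0 < 2 * θc - θ₀ xM := by linarith
  have hθ''0 : 0 < θc * (θ₀ xM + 2 * θc) / (2 * θc - θ₀ xM) := by positivity
  -- normalising constants
  have hc''0 : 0 < (2 * π * (θc * (θ₀ xM + 2 * θc) / (2 * θc - θ₀ xM))) ^
      (-(Module.finrank ℝ V3 : ℝ) / 2) := Real.rpow_pos_of_pos (by positivity) _
  have hcc0 : 0 < (2 * π * θc) ^ (-(Module.finrank ℝ V3 : ℝ) / 2) :=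
    Real.rpow_pos_of_pos (by positivity) _
  have hr : -(Module.finrank ℝ V3 : ℝ) / 2 ≤ 0 := by
    have h : (0 : ℝ) ≤ (Module.finrank ℝ V3 : ℝ) := Nat.cast_nonneg _
    linarith
  refine ⟨θc * (θ₀ xM + 2 * θc) / (2 * θc - θ₀ xM),
    (A * (2 * π * θ₀ xm) ^ (-(Module.finrank ℝ V3 : ℝ) / 2)) ^ 2 *
        Real.exp (2 * U ^ 2 / (2 * θc - θ₀ xM)) /
      ((2 * π * (θc * (θ₀ xM + 2 * θc) / (2 * θc - θ₀ xM))) ^ (-(Module.finrank ℝ V3 : ℝ) / 2) *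
        (2 * π * θc) ^ (-(Module.finrank ℝ V3 : ℝ) / 2)),
    hθ''0, by positivity, fun y => ?_⟩
  obtain ⟨x, v⟩ := y
  simp only [localGibbsProfile, Literature.Analysis.FluidPDE.localMaxwellian, Pi.one_apply,
    Pi.zero_apply, one_mul, sub_zero]
  have haA : a₀ x ≤ A := (le_abs_self _).trans (hA x)
  have hUx : ‖u₀ x‖ ≤ U := (le_abs_self _).trans (hU x)
  have hθx : 0 < θ₀ x := hθ0 x
  have hcθ0 : 0 ≤ (2 * π * θ₀ x) ^ (-(Module.finrank ℝ V3 : ℝ) / 2) :=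
    Real.rpow_nonneg (by positivity) _
  have hcθ : (2 * π * θ₀ x) ^ (-(Module.finrank ℝ V3 : ℝ) / 2) ≤
      (2 * π * θ₀ xm) ^ (-(Module.finrank ℝ V3 : ℝ) / 2) :=
    Real.rpow_le_rpow_of_nonpos (by positivity)
      (mul_le_mul_of_nonneg_left (hθmin x) (by positivity)) hr
  have he : Real.exp (-‖v - u₀ x‖ ^ 2 / (2 * θ₀ x)) ^ 2 ≤
      Real.exp (2 * U ^ 2 / (2 * θc - θ₀ xM)) *
        (Real.exp (-‖v‖ ^ 2 / (2 * (θc * (θ₀ xM + 2 * θc) / (2 * θc - θ₀ xM)))) *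
          Real.exp (-‖v‖ ^ 2 / (2 * θc))) := by
    rw [pow_two, ← Real.exp_add, ← Real.exp_add, ← Real.exp_add, Real.exp_le_exp]
    exact exponent_bound hθmax0 h2 (hθ0 x) (hθmax x) (u₀ x) v hUx
  exact sq_mul_le_aux (ha0 x).le haA hcθ0 hcθ he hc''0 hcc0

/-! ### Tensorisation and the configurational comparison -/

/-- Tensorisation of the pointwise domination on the hard-sphere domain:
`(𝟙_D f_P^{⊗n})² ≤ K₀ⁿ (𝟙_D f_R^{⊗n}) (𝟙_D f_Q^{⊗n})`. [folklore] -/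
theorem indicator_tensorPow_sq_le {n : ℕ} {fP fQ fR : T3 × V3 → ℝ} {K₀ : ℝ}
    (hdom : ∀ y, fP y ^ 2 ≤ K₀ * (fR y * fQ y))
    (D : Set (Config n (Fin 3) T3)) (z : Config n (Fin 3) T3) :
    (D.indicator (tensorPow n fP) z) ^ 2 ≤
      K₀ ^ n * (D.indicator (tensorPow n fR) z * D.indicator (tensorPow n fQ) z) := by
  by_cases hz : z ∈ D
  · rw [Set.indicator_of_mem hz, Set.indicator_of_mem hz, Set.indicator_of_mem hz]
    simp only [tensorPow]
    calc (∏ i, fP (z i)) ^ 2 = ∏ i, fP (z i) ^ 2 := (Finset.prod_pow _ _ _).symm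
      _ ≤ ∏ i, (K₀ * (fR (z i) * fQ (z i))) :=
          Finset.prod_le_prod (fun i _ => sq_nonneg _) (fun i _ => hdom _)
      _ = K₀ ^ n * ((∏ i, fR (z i)) * ∏ i, fQ (z i)) := by
          rw [Finset.prod_mul_distrib, Finset.prod_mul_distrib, Finset.prod_const, Finset.card_univ,
            Fintype.card_fin]
  · simp [Set.indicator_of_notMem hz]

/-- The configurational partition function in the external field `log a₀` dominates `a_minⁿ` times the
field-free one: `a_minⁿ Z_pos[1] ≤ Z_pos[a₀]` for `a_min ≤ a₀`. [folklore] -/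
theorem pow_mul_posPartition_one_le (ha : Continuous a₀) (ha0 : ∀ x, 0 ≤ a₀ x) {amin : ℝ}
    (hamin0 : 0 ≤ amin) (hamin : ∀ x, amin ≤ a₀ x) (ε : ℝ) (n : ℕ) :
    amin ^ n * posPartition 1 ε n ≤ posPartition a₀ ε n := by
  rw [posPartition, posPartition, ← integral_const_mul]
  refine integral_mono ((integrable_posWeight continuous_one (fun _ => zero_le_one) ε n).const_mul _)
    (integrable_posWeight ha ha0 ε n) fun x => ?_
  simp only [posWeight]
  by_cases hx : x ∈ posDomain ε n
  · rw [Set.indicator_of_mem hx, Set.indicator_of_mem hx]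
    simp only [Pi.one_apply, Finset.prod_const_one, mul_one]
    calc amin ^ n = ∏ _i : Fin n, amin := by simp
      _ ≤ ∏ i, a₀ (x i) := Finset.prod_le_prod (fun i _ => hamin0) (fun i _ => hamin _)
  · rw [Set.indicator_of_notMem hx, Set.indicator_of_notMem hx, mul_zero]

/-- The field-free hard-sphere-restricted tensor power of Maxwellians has total Lebesgue integral the
configurational partition function `Z_pos[1]` (velocities integrate to one). [folklore] -/
theorem lintegral_indicator_tensorPow_one {θ : ℝ} (hθ : 0 < θ) (ε : ℝ) (n : ℕ) :
    ∫⁻ z, ENNReal.ofReal ((hardSphereDomain (Torus.geometry (Fin 3)) n ε).indicator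
        (tensorPow n (localGibbsProfile 1 0 (fun _ => θ))) z) =
      ENNReal.ofReal (posPartition 1 ε n) := by
  have h := lintegral_gibbsWeight_mul (a₀ := 1) (u₀ := 0) (θ₀ := fun _ => θ) continuous_one
    continuous_const continuous_zero (fun _ => zero_le_one) (fun _ => hθ) ε n (G := fun _ => 1)
    measurable_const
  simp only [mul_one, lintegral_const, measure_univ] at h
  rw [h, ofReal_posPartition continuous_one (fun _ => zero_le_one)]

end RingDensityCertificateTiltTransfer

end Summit.AtomisticToContinuum.HydrodynamicLimit.Theorems

end
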